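import Summits.QuantumFields.YangMills.Theorems.BalabanUVNodesN15PerCubeGreenTwoGridSecondLettersOfReg335LipCube
import HarnessLib

/-!
# N15 = NE2, road (c) — PROGRAMME (PC), (PC-E): WHY THE DIVERGENCE FIT NEEDS MORE THAN (3.35)–(3.36) IN THE DATUM's WITNESS GAUGE — A TWO-SITE WITNESS: for every `ξ, C > 0` and every
# spacing `0 < η ≤ ξ` the alternating field `A = ±Cη∕(4ξ²)` on `ℤ∕2` (one direction, gauge `u ≡ 1`) satisfies EVERY clause of r06's `Reg336Cube` ((3.35)–(3.36)) at `(ξ, C)`, while its flat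
# second difference is `C∕(ηξ²)` — so NO constant `C₁` puts these witnesses in the Lipschitz clause of n15-c∕360's `Reg335LipCube` uniformly in `η` (dag-n15-c g33, n15-c∕365)

Cell `pub-ymgap`, seat `pub-ymgap-dag-n15-c` (generation g33; R134 (a) seat; HUMAN RULING D-0062; chair R424 venue).  `bears_on: R4∕N15 · K3⁸ SpineGivenEndpointR13SepCoPHV
(stmt-QuantumFields-27366)`; filed `--kind proof --supports stmt-QuantumFields-27366 --as helper` — COUNT-NEUTRAL.  Theorems only (a kernel-checked TIGHTNESS remark for the datum design of
n15-c∕356∕360; companion of HOME `EVIDENCE-N15C-G33-DIVERGENCE-FIT.md` §3), 0 `def`, 0 `sorry`.  Imports BY NAME n15-c∕360 (through it r06 `Reg336Cube`, `B9Eq39Adjoint.covD∕fluct∕curlη∕divPη`,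
`B9Eq3117Current.gaugeTr`).  Nothing in the tree is modified, no landed name re-declared.

WHAT AND WHY.  The (PC-E) chain reads its letters off the WITNESS gauge `(u, A)` of the per-cube datum (dag-n15-w2 `uN_opLetters_of_gauge335` onward).  n15-c∕358 showed that the divergence
fit `o_B` needs the oscillation of `∇A` over a coarse cell, i.e. (n15-c∕356∕360) a second-difference letter `|∇^η∇^ηA| < C₁ξ⁻³`.  THIS FILE certifies that the printed sup-norm clauses
(3.35)–(3.36) of [B9] p. 396, AS TYPED by r06 (`Reg336Cube`: `|A| < Cξ⁻¹`, `|∇^ηA| < Cξ⁻²`, `|∂^{η*}∂^ηA| < Cξ⁻³`), do NOT bound the second differences of their witness uniformly in the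
spacing: ★ `reg336_clauses_twoSite_alt` — on the carrier `ℤ∕2` with one direction (`ι = Unit`, where the curl and hence (3.36) vanish identically) the witness `u ≡ 1`, `A ≡ ±a`,
`a = Cη∕(4ξ²)`, `U = e^{iηA}` satisfies the five clauses of `Reg336Cube` at `(ξ, C)` whenever `0 < η ≤ ξ`; ★ `norm_secondDiff_twoSite_alt` — its flat second difference has norm EXACTLY
`C∕(ηξ²)`; ★★ `reg336_witness_not_lipschitz_uniformly` — hence for every `C₁` there is a spacing `η` at which this (3.35)–(3.36) witness violates the Lipschitz clause
`|∇^η∇^ηA| < C₁ξ⁻³`.  READING (honest, as in the memo): this is a statement about WITNESS gauges, not about the classes as `Prop`s — the two-site `U` is pure gauge, so a re-gauged witness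
(`A′ = 0`) is Lipschitz; what the certificate rules out is producing `o_B` by letter-reading from a (3.35)–(3.36) witness, the method of the chain; a producer from (3.35)–(3.36) alone must
RE-GAUGE, which is [Balaban1985RegularSpaces] Thm 2 (node N04), not bookkeeping.

HONEST FRAMING ∕ LIMITS.  A finite toy carrier (`ℤ∕2`, one direction, `𝔸 = ℂ`); elementary arithmetic; nothing of [B9]∕[B8]∕[B11] asserted.  NE2⁺ NOT PRINTED ∕ NOT proved; N15 of record
untouched; K3⁸ OPEN; counts of record UNMOVED (typed 28∕28 · discharged 8∕27); one finite 𝕋⁴ at fixed ε per index — NOT infinite volume, NOT OS on ℝ⁴, NOT a mass gap, NOT Clay.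
Restate-immune (no Theses import).
-/

set_option autoImplicit false

noncomputable section

namespace Summit.QuantumFields.YangMills.BalabanUVNodes.N15.CurvedSpecies

open Literature.MathematicalPhysics.QuantumFieldTheory.Balaban1983to89
open Literature.MathematicalPhysics.QuantumFieldTheory.Balaban1983to89.B9Eq39Adjoint (covD fluct curlη divPη divP)
open Literature.MathematicalPhysics.QuantumFieldTheory.Balaban1983to89.B9Eq3117Current (gaugeTr)
open Literature.MathematicalPhysics.QuantumFieldTheory.Balaban1983to89.B9Eq335RegularityClasses (Reg336Cube)

/-- the flat difference of the alternating two-site field: `A(z+1) − A(z) = ∓2a`, of norm `2|a|`. [folklore] -/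
theorem norm_covD_twoSite_alt (a : ℝ) (z : ZMod 2) :
    ‖covD (fun _ : Unit => Equiv.addRight (1 : ZMod 2)) (fun _ _ => (1 : ℂˣ)) () (fun w : ZMod 2 => if w = 0 then (a : ℂ) else -(a : ℂ)) z‖ = 2 * |a| := by
  set A : ZMod 2 → ℂ := fun w => if w = 0 then (a : ℂ) else -(a : ℂ) with hA
  have hA0 : A 0 = a := if_pos rfl
  have hA1 : A 1 = -a := if_neg one_ne_zero
  have h11 : (1 : ZMod 2) + 1 = 0 := rfl
  simp only [covD_one_apply', Equiv.coe_addRight]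
  rcases (show ∀ w : ZMod 2, w = 0 ∨ w = 1 by decide) z with h | h <;> subst h
  · rw [zero_add, hA0, hA1, show -(a : ℂ) - (a : ℂ) = ((-(2 * a) : ℝ) : ℂ) by push_cast; ring, Complex.norm_real, Real.norm_eq_abs, abs_neg, abs_mul, abs_two]
  · rw [h11, hA0, hA1, show (a : ℂ) - -(a : ℂ) = (((2 * a) : ℝ) : ℂ) by push_cast; ring, Complex.norm_real, Real.norm_eq_abs, abs_mul, abs_two]

/-- ★ THE SECOND DIFFERENCE OF THE WITNESS: `‖η⁻¹D¹(η⁻¹D¹A)(z)‖ = 4|a|∕η²` — at `a = Cη∕(4ξ²)` this is `C∕(ηξ²)`. [folklore] -/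
theorem norm_secondDiff_twoSite_alt {η : ℝ} (hη : 0 < η) (a : ℝ) (z : ZMod 2) :
    ‖((η : ℂ)⁻¹) • covD (fun _ : Unit => Equiv.addRight (1 : ZMod 2)) (fun _ _ => (1 : ℂˣ)) ()
        (fun w => ((η : ℂ)⁻¹) • covD (fun _ : Unit => Equiv.addRight (1 : ZMod 2)) (fun _ _ => (1 : ℂˣ)) () (fun w : ZMod 2 => if w = 0 then (a : ℂ) else -(a : ℂ)) w) z‖ =
      4 * |a| / η ^ 2 := by
  set A : ZMod 2 → ℂ := fun w => if w = 0 then (a : ℂ) else -(a : ℂ) with hA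
  have hA0 : A 0 = a := if_pos rfl
  have hA1 : A 1 = -a := if_neg one_ne_zero
  have h11 : (1 : ZMod 2) + 1 = 0 := rfl
  simp only [covD_one_apply', Equiv.coe_addRight]
  rw [← smul_sub, norm_smul, norm_smul, norm_inv, Complex.norm_real, Real.norm_of_nonneg hη.le]
  rcases (show ∀ w : ZMod 2, w = 0 ∨ w = 1 by decide) z with h | h <;> subst h
  · rw [zero_add, h11, hA0, hA1, show (a : ℂ) - -(a : ℂ) - (-(a : ℂ) - (a : ℂ)) = (((4 * a) : ℝ) : ℂ) by push_cast; ring, Complex.norm_real, Real.norm_eq_abs, abs_mul,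
      show |(4 : ℝ)| = 4 by norm_num]
    field_simp
  · rw [h11, zero_add, hA0, hA1, show -(a : ℂ) - (a : ℂ) - ((a : ℂ) - -(a : ℂ)) = ((-(4 * a) : ℝ) : ℂ) by push_cast; ring, Complex.norm_real, Real.norm_eq_abs, abs_neg, abs_mul,
      show |(4 : ℝ)| = 4 by norm_num]
    field_simp

/-- ★ **THE TWO-SITE ALTERNATING FIELD IS A (3.35)–(3.36) WITNESS**: for `0 < η ≤ ξ`, `0 < C`, with `a = Cη∕(4ξ²)`: the gauge `u ≡ 1` and `A ≡ ±a` on `ℤ∕2` (one direction) satisfy the five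
clauses of r06's `Reg336Cube` for `U := e^{iηA}` on the whole carrier at `(ξ, C)` — `|A| = Cη∕(4ξ²) < Cξ⁻¹`, `|η⁻¹D¹A| = C∕(2ξ²) < Cξ⁻²`, and the curl (hence `∂^{η*}∂^ηA`) vanishes in one
dimension. [cite: Balaban1985BackgroundPropagators, (3.35)–(3.36) p.396 (the clauses, as typed by r06)] -/
theorem reg336_clauses_twoSite_alt {η ξ C : ℝ} (hη : 0 < η) (hξ : 0 < ξ) (hC : 0 < C) (hηξ : η ≤ ξ) :
    Reg336Cube (fun _ : Unit => Equiv.addRight (1 : ZMod 2))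
      (fluct η (fun (_ : Unit) (w : ZMod 2) => if w = 0 then ((C * η / (4 * ξ ^ 2) : ℝ) : ℂ) else -((C * η / (4 * ξ ^ 2) : ℝ) : ℂ))) η Set.univ ξ C := by
  set a : ℝ := C * η / (4 * ξ ^ 2) with ha
  have ha0 : 0 < a := by rw [ha]; positivity
  refine ⟨fun _ => 1, fun _ w => if w = 0 then (a : ℂ) else -(a : ℂ), fun z _ => ⟨by simp, by simp⟩, fun κ z _ => ?_, fun κ z _ => ?_, fun κ ν z _ => ?_, fun μ z _ => ?_⟩
  · -- the gauge `u ≡ 1` does nothing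
    simp [gaugeTr]
  · -- `|A| = a < C∕ξ`
    have h1 : ‖(if z = 0 then (a : ℂ) else -(a : ℂ))‖ = a := by
      split_ifs <;> simp [Complex.norm_real, abs_of_pos ha0]
    rw [h1, ha]
    rw [div_lt_iff₀ (by positivity), show C * ξ⁻¹ * (4 * ξ ^ 2) = C * ξ * 4 by field_simp]
    nlinarith [mul_pos hC hξ]
  · -- `|η⁻¹D¹A| = 2a∕η = C∕(2ξ²) < C∕ξ²`
    rw [norm_smul, norm_inv, Complex.norm_real, Real.norm_of_nonneg hη.le, norm_covD_twoSite_alt, abs_of_pos ha0, ha]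
    rw [show η⁻¹ * (2 * (C * η / (4 * ξ ^ 2))) = C * (ξ ^ 2)⁻¹ / 2 by field_simp; ring]
    exact half_lt_self (by positivity)
  · -- one direction: the curl vanishes, so does its adjoint divergence
    have h0 : divPη (fun _ : Unit => Equiv.addRight (1 : ZMod 2)) (fun _ _ => (1 : ℂˣ)) η
        (curlη (fun _ : Unit => Equiv.addRight (1 : ZMod 2)) (fun _ _ => (1 : ℂˣ)) η fun _ w => if w = 0 then (a : ℂ) else -(a : ℂ)) μ z = 0 := by
      simp [divPη, divP]
    rw [h0, norm_zero]; positivity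

/-- ★★ **NO LIPSCHITZ CONSTANT WORKS FOR THESE (3.35)–(3.36) WITNESSES UNIFORMLY IN THE SPACING**: for every `ξ, C, C₁ > 0` there is a spacing `0 < η ≤ ξ` and a gauge datum `(u ≡ 1, A)`
satisfying the five clauses of `Reg336Cube` at `(ξ, C)` (previous theorem) whose flat second difference has norm `≥ C₁ξ⁻³` — it violates the Lipschitz clause of n15-c∕360's `Reg335LipCube`
with constant `C₁`.  (Witness level; see the module docstring for what this does NOT say.) [cite: Balaban1985BackgroundPropagators, (3.35)–(3.36) p.396; Balaban1985Variational, Thm 1 (9) p.279 (the clause at β = 1)] -/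
theorem reg336_witness_not_lipschitz_uniformly {ξ C C₁ : ℝ} (hξ : 0 < ξ) (hC : 0 < C) (hC₁ : 0 < C₁) :
    ∃ η : ℝ, 0 < η ∧ η ≤ ξ ∧ ∃ A : Unit → ZMod 2 → ℂ,
      Reg336Cube (fun _ : Unit => Equiv.addRight (1 : ZMod 2)) (fluct η A) η Set.univ ξ C ∧
      (∀ κ z, gaugeTr (fun _ : Unit => Equiv.addRight (1 : ZMod 2)) (fun _ => (1 : ℂˣ)) (fluct η A) κ z = fluct η A κ z) ∧
      (∀ κ z, ‖A κ z‖ < C * ξ⁻¹) ∧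
      (∀ κ ν z, ‖((η : ℂ)⁻¹) • covD (fun _ : Unit => Equiv.addRight (1 : ZMod 2)) (fun _ _ => (1 : ℂˣ)) κ (A ν) z‖ < C * (ξ ^ 2)⁻¹) ∧
      ¬ (∀ κ κ' ν (z : ZMod 2), ‖((η : ℂ)⁻¹) • covD (fun _ : Unit => Equiv.addRight (1 : ZMod 2)) (fun _ _ => (1 : ℂˣ)) κ'
          (fun w => ((η : ℂ)⁻¹) • covD (fun _ : Unit => Equiv.addRight (1 : ZMod 2)) (fun _ _ => (1 : ℂˣ)) κ (A ν) w) z‖ < C₁ * (ξ ^ 3)⁻¹) := by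
  -- choose `η = min ξ (Cξ∕C₁)`: then `C∕(ηξ²) ≥ C₁∕ξ³`
  set η : ℝ := min ξ (C * ξ / C₁) with hηdef
  have hη : 0 < η := by rw [hηdef]; exact lt_min hξ (by positivity)
  have hηξ : η ≤ ξ := min_le_left _ _
  have hηC : η ≤ C * ξ / C₁ := min_le_right _ _
  set a : ℝ := C * η / (4 * ξ ^ 2) with ha
  have ha0 : 0 < a := by rw [ha]; positivity
  have hW := reg336_clauses_twoSite_alt hη hξ hC hηξ
  refine ⟨η, hη, hηξ, fun _ w => if w = 0 then ((C * η / (4 * ξ ^ 2) : ℝ) : ℂ) else -((C * η / (4 * ξ ^ 2) : ℝ) : ℂ), hW, fun κ z => by simp [gaugeTr], fun κ z => ?_,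
    fun κ ν z => ?_, fun h => ?_⟩
  · have h1 : ‖(if z = 0 then (a : ℂ) else -(a : ℂ))‖ = a := by
      split_ifs <;> simp [Complex.norm_real, abs_of_pos ha0]
    rw [← ha, h1, ha, div_lt_iff₀ (by positivity), show C * ξ⁻¹ * (4 * ξ ^ 2) = C * ξ * 4 by field_simp]
    nlinarith [mul_pos hC hξ]
  · rw [← ha, norm_smul, norm_inv, Complex.norm_real, Real.norm_of_nonneg hη.le, norm_covD_twoSite_alt, abs_of_pos ha0, ha]
    rw [show η⁻¹ * (2 * (C * η / (4 * ξ ^ 2))) = C * (ξ ^ 2)⁻¹ / 2 by field_simp; ring]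
    exact half_lt_self (by positivity)
  · have h4 := h () () () 0
    rw [← ha, norm_secondDiff_twoSite_alt hη a 0, abs_of_pos ha0, ha] at h4
    -- `4a∕η² = C∕(ηξ²) ≥ C₁∕ξ³` since `η ≤ Cξ∕C₁`
    have e1 : 4 * (C * η / (4 * ξ ^ 2)) / η ^ 2 = C / (η * ξ ^ 2) := by field_simp
    rw [e1] at h4
    have h5 : C₁ * (ξ ^ 3)⁻¹ ≤ C / (η * ξ ^ 2) := by
      have hηC' : η * C₁ ≤ C * ξ := by rwa [le_div_iff₀ hC₁] at hηC
      rw [← div_eq_mul_inv, div_le_div_iff₀ (by positivity) (by positivity)]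
      calc C₁ * (η * ξ ^ 2) = (η * C₁) * ξ ^ 2 := by ring
        _ ≤ (C * ξ) * ξ ^ 2 := mul_le_mul_of_nonneg_right hηC' (by positivity)
        _ = C * ξ ^ 3 := by ring
    exact absurd h4 (not_lt.mpr h5)

end Summit.QuantumFields.YangMills.BalabanUVNodes.N15.CurvedSpecies

end
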